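import Summits.HodgeConjecture.HodgeConjecture.Theorems.NikulinTwinTransportTwinSimilitudeAlgebraicCMNormSelfAnchor
import Summits.HodgeConjecture.HodgeConjecture.Theorems.NikulinTwinTransportTwinSimilitudeAlgebraicStubWittCompletionAux
import Summits.HodgeConjecture.HodgeConjecture.Theorems.NikulinTwinTransportTwinSimilitudeAlgebraicStubDivisorCorrections
import Literature.AlgebraicGeometry.Surfaces.K3HodgeTypesHolds
import HarnessLib

/-!
# Route NikulinTwinTransport · crux X = `TwinSimilitudeAlgebraic` (stmt-HodgeConjecture-13674) —
# stub `stub_cmSelfSimilitudeFromIsometries` of line `hyperkaehler-nikulin-anchors` (reshape r11, lead c6):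
# a CM-norm-2 self-similitude is algebraic, from Buskin's THEOREM

Let `S` be a projective K3 surface, `H := H²(S(ℂ); ℂ)`, and `e : H → H` a RATIONAL `2`-SELF-SIMILITUDE
(`(x.y) = a·p ⟹ (ex.ey) = 2a·p`) with a NON-REAL eigenvalue `t` on a non-zero `(2,0)`-class (a "CM-norm-2
structure").  This file proves the registered stub `stub_cmSelfSimilitudeFromIsometries` of the line's
skeleton (r11): granted its three linear-algebra antecedents (`CMCayleyDecomposition`, `CMPolyComplexify`,
`CMRationalForm`, sibling stubs taken as hypotheses), K3 markings, Buskin's theorem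
(`HodgeIsometryAlgebraic`), the two `(1,1)` items, the Hodge index theorem and `DivisorCorrections`,
the class of `e` is ALGEBRAIC: `e = [γ]_*` with `γ ∈ N²H⁴(S × S)`.

Proof (pure assembly).  Mark `S` by `(η, p₀, x₀)`; `J := η e η⁻¹` is defined over `ℚ` with `ℚ`-form `Jq`
(`CMRationalForm`), and `Jq = Σᵢ cᵢ qᵢ(Jq) + Σₗ (·.aₗ) bₗ` with `qᵢ(Jq)` isometries of `Λ_ℚ` and
`aₗ, bₗ` rational Néron–Severi vectors (`CMCayleyDecomposition`, a Cayley-transform decomposition in the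
CM field).  Complexify: `Uᵢ := qᵢ(J)` is an isometry of `Λ_ℂ` defined over `ℚ` (`CMPolyComplexify`) fixing
the period LINE (`x₀` is a `t`-eigenvector of `J`, hence a `qᵢ(t)`-eigenvector of `qᵢ(J)`), so
`η⁻¹ Uᵢ η` is a rational Hodge ISOMETRY of `H²(S)`, algebraic by Buskin at the pair `(S, S)`; each
`x ↦ (ηx.aₗ) η⁻¹bₗ` is a product of divisors, algebraic by `DivisorCorrections`; the operator identity
`J = Σᵢ cᵢ Uᵢ + Σₗ (·.aₗ) bₗ` holds on the rational standard basis of `Λ_ℂ`, hence everywhere, and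
conjugating by `η` writes `e` as a `ℂ`-linear combination of algebraic correspondences
(`induced_smul`, `induced_sum`, `induced_add`).  No definitions, no new named facts, no `sorry`.
-/

noncomputable section

set_option linter.dupNamespace false

open CategoryTheory MonoidalCategory
open scoped Manifold Matrix
open Literature.AlgebraicGeometry.Motives Literature.AlgebraicGeometry.HodgeTheory
open Literature.AlgebraicGeometry.Surfaces Literature.Geometry.Kaehler
open Literature.AlgebraicTopology.SingularHomology
open Summit.HodgeConjecture.HodgeConjecture.Theses.NikulinTwinTransport

namespace Summit.HodgeConjecture.HodgeConjecture.Theorems.NikulinTwinTransport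

/-! ## Local notations (verbatim those of the line's skeleton r11) -/

/-- `Gen[S, p]`: `p` is an integral generator of `H⁴(S(ℂ); ℂ)`. Local notation only. -/
local notation3 (prettyPrint := false) "Gen[" S ", " p "]" =>
  (IsIntegralClass p ∧ ∀ q : complexBetti S (2 * 2), IsIntegralClass q → ∃ n : ℤ, q = n • p)

/-- `Corr[μ, S, S', hS, hS' ; γ, y] = [γ]_* y = fst_*(snd^* y ∪ γ)`. Local notation only. -/
local notation3 (prettyPrint := false) "Corr[" μ ", " S ", " S' ", " hS ", " hS' " ; " γ ", " y "]" =>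
  complexGysin μ
    (IsSmoothProjective.tensor_holds (IsK3Surface.isSmoothProjective hS)
      (IsK3Surface.isSmoothProjective hS'))
    (IsK3Surface.isSmoothProjective hS) (SemiCartesianMonoidalCategory.fst S S')
    (rfl : 2 * 1 + 2 * 2 + 2 * 2 = 2 * 1 + 2 * (2 + 2))
    (cupProduct (rfl : 2 * 1 + 2 * 2 = 2 * 1 + 2 * 2)
      (complexBetti.map (SemiCartesianMonoidalCategory.snd S S') (2 * 1) y) γ)

/-- `MarkedK3[S, η, p, x]`: a marked K3 surface with period `x`. Local notation only. -/
local notation3 (prettyPrint := false) "MarkedK3[" S ", " η ", " p ", " x "]" =>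
  (IsIntegralClass p ∧
    (∀ q : complexBetti S (2 * 2), IsIntegralClass q → ∃ n : ℤ, q = n • p) ∧
    (∀ c : complexBetti S (2 * 1), IsIntegralClass c ↔ ∃ v : K3Index → ℤ, η c = fun i => (v i : ℂ)) ∧
    (∀ a b : complexBetti S (2 * 1),
        cupProduct (rfl : 2 * 1 + 2 * 1 = 2 * 2) a b = k3Form (η a) (η b) • p) ∧
    IsOfHodgeType 2 S (2 * 1) 2 0 (LinearEquiv.symm η x) ∧
    (∀ τ : complexBetti S (2 * 1), IsOfHodgeType 2 S (2 * 1) 2 0 τ → ∃ t : ℂ, τ = t • LinearEquiv.symm η x))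

/-- `PeriodPt[x]`: `(x.x) = 0`, `(x̄.x) > 0`, a positive lattice vector in `x^⊥`. Local notation only. -/
local notation3 (prettyPrint := false) "PeriodPt[" x "]" =>
  (k3Form x x = 0 ∧ 0 < (k3Form (star x) x).re ∧
    ∃ u : K3Index → ℤ, k3Form (fun i => (u i : ℂ)) x = 0 ∧ 0 < ∑ i, ∑ j, u i * k3Gram i j * u j)

/-- `DivisorCorrections`: products of divisors act as rank-one maps (the landed `stub_divisorCorrections`, r1 stub 2
of the line; verbatim its skeleton `def`). Local notation only. -/
local notation3 (prettyPrint := false) "DivisorCorrections" =>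
  ∀ (μ : OrientationFamily), μ.HasPoincareDuality →
    ∀ (S Sg : SchemeOver ℂ) (hS : IsK3Surface S) (hSg : IsK3Surface Sg)
      (p : complexBetti S (2 * 2)), p ≠ 0 →
      ∀ a ∈ algebraicClasses S 1, ∀ b ∈ algebraicClasses Sg 1,
        ∃ γ ∈ algebraicClasses (MonoidalCategoryStruct.tensorObj Sg S) 2,
          ∀ (x : complexBetti S (2 * 1)) (t : ℂ),
            cupProduct (rfl : 2 * 1 + 2 * 1 = 2 * 2) x a = t • p →
              Corr[μ, Sg, S, hSg, hS ; γ, x] = t • b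

/-- `CMCayleyDecomposition` (r11 stub 10 of the line; verbatim its skeleton `def`). Local notation only. -/
local notation3 (prettyPrint := false) "CMCayleyDecomposition" =>
  ∀ (V : Type) [AddCommGroup V] [Module ℚ V] [FiniteDimensional ℚ V]
    (B : LinearMap.BilinForm ℚ V), B.IsSymm → B.Nondegenerate →
    ∀ (J : V ≃ₗ[ℚ] V), (∀ x y, B (J x) (J y) = 2 * B x y) →
    ∀ (N : Submodule ℚ V), (B.restrict N).Nondegenerate → (∀ u ∈ N, J u ∈ N) →
    (∀ w ∈ B.orthogonal N, J (J w) = (2 : ℚ) • w → w = 0) →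
    ∃ (m : ℕ) (c : Fin m → ℚ) (q : Fin m → Polynomial ℚ) (k : ℕ) (a b : Fin k → V),
      (∀ i x y, B (Polynomial.aeval J.toLinearMap (q i) x) (Polynomial.aeval J.toLinearMap (q i) y) = B x y) ∧
      (∀ l, a l ∈ N) ∧ (∀ l, b l ∈ N) ∧
      ∀ x, J x = ∑ i, c i • Polynomial.aeval J.toLinearMap (q i) x + ∑ l, B x (a l) • b l

/-- `CMPolyComplexify` (r11 stub 11 of the line; verbatim its skeleton `def`). Local notation only. -/
local notation3 (prettyPrint := false) "CMPolyComplexify" =>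
  ∀ (J : Module.End ℂ (K3Index → ℂ)) (Jq : Module.End ℚ (K3Index → ℚ)),
    (∀ u : K3Index → ℚ, J (fun i => (u i : ℂ)) = fun i => (Jq u i : ℂ)) →
    ∀ q : Polynomial ℚ,
      (∀ u : K3Index → ℚ,
        Polynomial.aeval J (q.map (algebraMap ℚ ℂ)) (fun i => (u i : ℂ)) =
          fun i => (Polynomial.aeval Jq q u i : ℂ)) ∧
      ((∀ v w, k3FormRat (Polynomial.aeval Jq q v) (Polynomial.aeval Jq q w) = k3FormRat v w) →
        ∀ a b, k3Form (Polynomial.aeval J (q.map (algebraMap ℚ ℂ)) a)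
          (Polynomial.aeval J (q.map (algebraMap ℚ ℂ)) b) = k3Form a b)

/-- `CMRationalForm` (r11 stub 12 of the line; verbatim its skeleton `def`). Local notation only. -/
local notation3 (prettyPrint := false) "CMRationalForm" =>
  Huybrechts_K3_marking_exists → LefschetzOneOneK3 → AlgebraicClassesOneOneK3 →
  (∀ (S : SchemeOver ℂ), IsK3Surface S → hodgeIndex_surface S) →
    ∀ (S : SchemeOver ℂ) (hS : IsK3Surface S) (p : complexBetti S (2 * 2)), Gen[S, p] →
    ∀ (e : complexBetti S (2 * 1) →ₗ[ℂ] complexBetti S (2 * 1)),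
      (∀ x, IsRationalClass x → IsRationalClass (e x)) →
      (∀ (x y : complexBetti S (2 * 1)) (a : ℂ),
        cupProduct (rfl : 2 * 1 + 2 * 1 = 2 * 2) x y = a • p →
          cupProduct (rfl : 2 * 1 + 2 * 1 = 2 * 2) (e x) (e y) = ((2 : ℂ) * a) • p) →
      ∀ (σ : complexBetti S (2 * 1)) (t : ℂ), IsOfHodgeType 2 S (2 * 1) 2 0 σ → σ ≠ 0 → t.im ≠ 0 →
        e σ = t • σ →
      ∀ (η : complexBetti S (2 * 1) ≃ₗ[ℂ] (K3Index → ℂ)) (p₀ : complexBetti S (2 * 2)) (x₀ : K3Index → ℂ),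
        MarkedK3[S, η, p₀, x₀] →
        ∃ (Jq : (K3Index → ℚ) ≃ₗ[ℚ] (K3Index → ℚ)) (NQ : Submodule ℚ (K3Index → ℚ)),
          (∀ u : K3Index → ℚ, η (e (η.symm fun i => (u i : ℂ))) = fun i => (Jq u i : ℂ)) ∧
          (∀ v w, k3FormRat (Jq v) (Jq w) = 2 * k3FormRat v w) ∧
          (∀ u, u ∈ NQ ↔ η.symm (fun j => (u j : ℂ)) ∈ algebraicClasses S 1) ∧
          (k3FormRat.restrict NQ).Nondegenerate ∧
          (∀ u ∈ NQ, Jq u ∈ NQ) ∧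
          (∀ w ∈ k3FormRat.orthogonal NQ, Jq (Jq w) = (2 : ℚ) • w → w = 0)

/-! ## The stub -/

/-- **A CM-norm-2 self-similitude of `H²` of a projective K3 surface is algebraic** (registered stub
`stub_cmSelfSimilitudeFromIsometries`, THE ASSEMBLY of line `hyperkaehler-nikulin-anchors` r11): granted the
Cayley decomposition of the `ℚ`-form of `e` into polynomial isometries plus rank-one divisor maps
(`CMCayleyDecomposition`, `CMPolyComplexify`, `CMRationalForm`), K3 markings, Buskin's theorem
`HodgeIsometryAlgebraic` (every rational Hodge isometry `H²(S′) → H²(S)` is algebraic) and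
`DivisorCorrections`, a rational `2`-self-similitude `e` of `H²(S(ℂ); ℂ)` with a non-real eigenvalue on a
non-zero `(2,0)`-class is `[γ]_*` for an algebraic `γ` on `S ⊗ S`: through a marking, `e` is a `ℚ`-linear
combination of rational Hodge isometries (Buskin) and of products of divisors.
[cite: Buskin2019, Thm. 1.1 and §6.2] [cite: Huybrechts2019, Cor. 0.4 (ii) and §1]
[cite: Huybrechts2016K3, Ch. 3 Cor. 3.6 and Thm. 3.7] -/
theorem stub_cmSelfSimilitudeFromIsometries :
    CMCayleyDecomposition → CMPolyComplexify → CMRationalForm →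
    Huybrechts_K3_marking_exists → HodgeIsometryAlgebraic → LefschetzOneOneK3 → AlgebraicClassesOneOneK3 →
    (∀ (S : SchemeOver ℂ), IsK3Surface S → hodgeIndex_surface S) → DivisorCorrections →
    ∀ (μ : OrientationFamily), μ.HasPoincareDuality →
      ∀ (S : SchemeOver ℂ) (hS : IsK3Surface S) (p : complexBetti S (2 * 2)), Gen[S, p] →
      ∀ (e : complexBetti S (2 * 1) →ₗ[ℂ] complexBetti S (2 * 1)),
        (∀ x, IsRationalClass x → IsRationalClass (e x)) →
        (∀ (x y : complexBetti S (2 * 1)) (a : ℂ),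
          cupProduct (rfl : 2 * 1 + 2 * 1 = 2 * 2) x y = a • p →
            cupProduct (rfl : 2 * 1 + 2 * 1 = 2 * 2) (e x) (e y) = ((2 : ℂ) * a) • p) →
        ∀ (σ : complexBetti S (2 * 1)) (t : ℂ), IsOfHodgeType 2 S (2 * 1) 2 0 σ → σ ≠ 0 → t.im ≠ 0 →
          e σ = t • σ →
        ∃ γ ∈ algebraicClasses (MonoidalCategoryStruct.tensorObj S S) 2,
          ∀ x : complexBetti S (2 * 1), e x = Corr[μ, S, S, hS, hS ; γ, x] := by
  intro hA hP hR hmk hB hL hN hHI hDC μ hμ S hS p hp e he_rat he_sim σ t hσ hσ0 htim heσ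
  classical
  -- (1) mark `S`, read `e` through the marking
  obtain ⟨η, p₀, x₀, hp₀0, hm, hx⟩ := hmk S hS
  obtain ⟨Jq, NQ, hJq, hJq2, memNQ, hNQ, hJN, hT⟩ :=
    hR hmk hL hN hHI S hS p hp e he_rat he_sim σ t hσ hσ0 htim heσ η p₀ x₀ hm
  obtain ⟨-, -, hJx, hJe⟩ := cmNorm_markingConj hS hp η p₀ x₀ hm e he_rat he_sim hσ hσ0 heσ
  obtain ⟨hp₀int, hgen₀, hint, hcup, h20, -⟩ := hm
  obtain ⟨-, hxpos, -⟩ := hx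
  set J : Module.End ℂ (K3Index → ℂ) := η.toLinearMap ∘ₗ e ∘ₗ η.symm.toLinearMap with hJdef
  have hJq' : ∀ u : K3Index → ℚ, J (fun i => (u i : ℂ)) = fun i => ((Jq.toLinearMap u) i : ℂ) :=
    fun u => by
      simp only [hJdef, LinearMap.coe_comp, LinearEquiv.coe_coe, Function.comp_apply]
      exact hJq u
  -- (2) the Cayley decomposition of the `ℚ`-form, and its complexification
  obtain ⟨m, c, q, k, a, b, hiso, ha, hb, hdec⟩ :=
    hA (K3Index → ℚ) k3FormRat k3FormRat_isSymm k3FormRat_nondegenerate Jq hJq2 NQ hNQ hJN hT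
  have hdec' : ∀ u : K3Index → ℚ, Jq u =
      ∑ i, c i • Polynomial.aeval Jq.toLinearMap (q i) u + ∑ l, k3FormRat u (a l) • b l := hdec
  have hiso' : ∀ i (v w : K3Index → ℚ), k3FormRat (Polynomial.aeval Jq.toLinearMap (q i) v)
      (Polynomial.aeval Jq.toLinearMap (q i) w) = k3FormRat v w := hiso
  have ha' : ∀ l, η.symm (fun j => (a l j : ℂ)) ∈ algebraicClasses S 1 := fun l => (memNQ _).1 (ha l)
  have hb' : ∀ l, η.symm (fun j => (b l j : ℂ)) ∈ algebraicClasses S 1 := fun l => (memNQ _).1 (hb l)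
  obtain ⟨U, hUdef⟩ : ∃ U : Fin m → Module.End ℂ (K3Index → ℂ),
      U = fun i => Polynomial.aeval J ((q i).map (algebraMap ℚ ℂ)) := ⟨_, rfl⟩
  have hUcast : ∀ i (u : K3Index → ℚ),
      U i (fun j => (u j : ℂ)) = fun j => ((Polynomial.aeval Jq.toLinearMap (q i) u) j : ℂ) :=
    fun i u => by
      rw [hUdef]
      exact (hP J Jq.toLinearMap hJq' (q i)).1 u
  have hUiso : ∀ i (z w : K3Index → ℂ), k3Form (U i z) (U i w) = 1 * k3Form z w := fun i z w => by
    rw [hUdef, one_mul]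
    exact (hP J Jq.toLinearMap hJq' (q i)).2 (hiso' i) z w
  have hUeig : ∀ i, U i x₀ = (((q i).map (algebraMap ℚ ℂ)).eval t) • x₀ := fun i => by
    rw [hUdef]
    exact Module.End.aeval_apply_of_mem_apply_eq_smul (p := (q i).map (algebraMap ℚ ℂ)) hJx
  have hUrat : ∀ i (v : K3Index → ℤ), ∃ w : K3Index → ℚ,
      U i (fun j => (v j : ℂ)) = fun j => (w j : ℂ) := fun i v =>
    ⟨Polynomial.aeval Jq.toLinearMap (q i) (fun j => (v j : ℚ)), by
      rw [intCast_eq_ratCast_intCast]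
      exact hUcast i _⟩
  -- (3) the operator identity `J = Σ cᵢ Uᵢ + Σ (·.aₗ) bₗ` on `Λ_ℂ` (checked on the rational basis)
  have key : J = ∑ i, ((c i : ℚ) : ℂ) • U i +
      ∑ l, (k3FormC.flip (fun j => (a l j : ℂ))).smulRight (fun j => (b l j : ℂ)) := by
    refine (Pi.basisFun ℂ K3Index).ext fun j₀ => ?_
    rw [basisFun_eq_ratCastΛ, LinearMap.add_apply, LinearMap.sum_apply, LinearMap.sum_apply, hJq',
      LinearEquiv.coe_coe, hdec', ratCastΛ_add, ratCastΛ_sum, ratCastΛ_sum]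
    congr 1
    · refine Finset.sum_congr rfl fun i _ => ?_
      rw [ratCastΛ_smul, LinearMap.smul_apply, hUcast]
    · refine Finset.sum_congr rfl fun l _ => ?_
      rw [ratCastΛ_smul, LinearMap.smulRight_apply, LinearMap.BilinForm.flip_apply, k3FormC_apply,
        k3Form_ratCast]
  have hΛ : ∀ z, J z = ∑ i, ((c i : ℚ) : ℂ) • U i z +
      ∑ l, k3Form z (fun j => (a l j : ℂ)) • fun j => (b l j : ℂ) := fun z => by
    have hz := LinearMap.congr_fun key z
    simpa only [LinearMap.add_apply, LinearMap.sum_apply, LinearMap.smul_apply,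
      LinearMap.smulRight_apply, LinearMap.BilinForm.flip_apply, k3FormC_apply] using hz
  -- (4) the pieces on `H²(S)`: `Φᵢ := η⁻¹ Uᵢ η`, `Dₗ := (η · . aₗ) η⁻¹ bₗ`
  obtain ⟨Φ, hΦdef⟩ : ∃ Φ : Fin m → (complexBetti S (2 * 1) →ₗ[ℂ] complexBetti S (2 * 1)),
      Φ = fun i => η.symm.toLinearMap ∘ₗ U i ∘ₗ η.toLinearMap := ⟨_, rfl⟩
  have hΦapp : ∀ i y, Φ i y = η.symm (U i (η y)) := fun i y => by
    simp only [hΦdef, LinearMap.coe_comp, LinearEquiv.coe_coe, Function.comp_apply]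
  obtain ⟨D, hDdef⟩ : ∃ D : Fin k → (complexBetti S (2 * 1) →ₗ[ℂ] complexBetti S (2 * 1)),
      D = fun l => ((k3FormC.flip (fun j => (a l j : ℂ))) ∘ₗ η.toLinearMap).smulRight
        (η.symm fun j => (b l j : ℂ)) := ⟨_, rfl⟩
  have hDapp : ∀ l y, D l y = k3Form (η y) (fun j => (a l j : ℂ)) • η.symm (fun j => (b l j : ℂ)) :=
    fun l y => by
      simp only [hDdef, LinearMap.smulRight_apply, LinearMap.coe_comp, LinearEquiv.coe_coe,
        Function.comp_apply, LinearMap.BilinForm.flip_apply, k3FormC_apply]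
  have he_dec : ∀ y, e y = (∑ i, ((c i : ℚ) : ℂ) • Φ i + ∑ l, D l) y := fun y => by
    rw [← hJe y, hΛ (η y), map_add, map_sum, map_sum, LinearMap.add_apply, LinearMap.sum_apply,
      LinearMap.sum_apply]
    congr 1
    · refine Finset.sum_congr rfl fun i _ => ?_
      rw [map_smul, LinearMap.smul_apply, hΦapp]
    · refine Finset.sum_congr rfl fun l _ => ?_
      rw [map_smul, hDapp]
  -- (5) each `Φᵢ` is a rational Hodge isometry of `H²(S)`, algebraic by Buskin at `(S, S)`
  have hΦalg : ∀ i, ∃ γ ∈ algebraicClasses (MonoidalCategoryStruct.tensorObj S S) 2,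
      ∀ y : complexBetti S (2 * 1), Φ i y = Corr[μ, S, S, hS, hS ; γ, y] := by
    intro i
    refine hB μ hμ S S hS hS p₀ p₀ ⟨hp₀int, hgen₀⟩ ⟨hp₀int, hgen₀⟩ (Φ i) ?_ ?_ ?_
    · intro y hy
      rw [hΦapp]
      exact isRationalClass_markingConj η η (U i) hS hS hint hint (hUrat i) hy
    · intro i' j y hy
      rw [hΦapp]
      exact isOfHodgeType_markingConj η p₀ x₀ η p₀ x₀ (U i) Huybrechts_K3_hodgeTypes_H2_holds hS hS hint
        hcup h20 hxpos hint hcup hp₀0 h20 hxpos (hUrat i) (one_ne_zero' ℂ) (hUiso i) ⟨_, hUeig i⟩ i' j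
        y hy
    · intro y z a' h
      rw [hΦapp, hΦapp]
      have h1 := cupProduct_markingConj η p₀ η p₀ (U i) hp₀0 hcup hcup (hUiso i) y z a' h
      rwa [one_mul] at h1
  -- (6) each `Dₗ` is a product of divisors, algebraic by `DivisorCorrections`
  have hDalg : ∀ l, ∃ γ ∈ algebraicClasses (MonoidalCategoryStruct.tensorObj S S) 2,
      ∀ y : complexBetti S (2 * 1), D l y = Corr[μ, S, S, hS, hS ; γ, y] := by
    intro l
    obtain ⟨γ, hγ, hγact⟩ := hDC μ hμ S S hS hS p₀ hp₀0 (η.symm fun j => (a l j : ℂ)) (ha' l)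
      (η.symm fun j => (b l j : ℂ)) (hb' l)
    refine ⟨γ, hγ, fun y => ?_⟩
    rw [hDapp]
    refine (hγact y _ ?_).symm
    rw [hcup, LinearEquiv.apply_symm_apply]
  -- (7) sum up
  obtain ⟨γ, hγ, hsum⟩ : ∃ γ ∈ algebraicClasses (MonoidalCategoryStruct.tensorObj S S) 2,
      ∀ y : complexBetti S (2 * 1),
        (∑ i, ((c i : ℚ) : ℂ) • Φ i + ∑ l, D l) y = Corr[μ, S, S, hS, hS ; γ, y] := by
    refine induced_add (IsSmoothProjective.tensor_holds (IsK3Surface.isSmoothProjective hS)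
      (IsK3Surface.isSmoothProjective hS)) (IsK3Surface.isSmoothProjective hS)
      (rfl : 2 * 1 + 2 * 2 = 2 * 1 + 2 * 2) (rfl : 2 * 1 + 2 * 2 + 2 * 2 = 2 * 1 + 2 * (2 + 2)) ?_ ?_
    · exact induced_sum (IsSmoothProjective.tensor_holds (IsK3Surface.isSmoothProjective hS)
        (IsK3Surface.isSmoothProjective hS)) (IsK3Surface.isSmoothProjective hS)
        (rfl : 2 * 1 + 2 * 2 = 2 * 1 + 2 * 2) (rfl : 2 * 1 + 2 * 2 + 2 * 2 = 2 * 1 + 2 * (2 + 2))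
        Finset.univ (fun i => ((c i : ℚ) : ℂ) • Φ i) fun i _ =>
          induced_smul (IsSmoothProjective.tensor_holds (IsK3Surface.isSmoothProjective hS)
            (IsK3Surface.isSmoothProjective hS)) (IsK3Surface.isSmoothProjective hS)
            (rfl : 2 * 1 + 2 * 2 = 2 * 1 + 2 * 2) (rfl : 2 * 1 + 2 * 2 + 2 * 2 = 2 * 1 + 2 * (2 + 2))
            ((c i : ℚ) : ℂ) (hΦalg i)
    · exact induced_sum (IsSmoothProjective.tensor_holds (IsK3Surface.isSmoothProjective hS)
        (IsK3Surface.isSmoothProjective hS)) (IsK3Surface.isSmoothProjective hS)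
        (rfl : 2 * 1 + 2 * 2 = 2 * 1 + 2 * 2) (rfl : 2 * 1 + 2 * 2 + 2 * 2 = 2 * 1 + 2 * (2 + 2))
        Finset.univ D fun l _ => hDalg l
  exact ⟨γ, hγ, fun y => by rw [he_dec y]; exact hsum y⟩

end Summit.HodgeConjecture.HodgeConjecture.Theorems.NikulinTwinTransport

end
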